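import Summits.QuantumFields.YangMills.Theorems.BalabanUVNodesN12FlatRightInverseLetterFloorWeighted
import Summits.QuantumFields.YangMills.Theorems.BalabanUVNodesN12FlatLinAvgOntoPins

/-!
# BalabanUVNodes ∕ N12 — (J-b) module H6: THE LETTER FLOOR AT THE RECORD's `𝐁_k(Z)` UNDER STRUCTURAL HYPOTHESES ONLY — the plaquette of rows is PRODUCED (torus connectivity + the collar of
# module H2a): whenever `Ω_{i+1}(Z)^{(i+1)}` is a non-empty proper subset of the `(i+1)`-torus (`1 ≤ i`, `i + 1 ≤ k`), every right inverse `Rf` of J-C's flat `Lf` at `Bj M₁ Z k` obeys the floor at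
# level `i`: sup-currency `(L^d)^i·‖↑E‖²_op ≤ 16·(L²)^i·ρ²·‖E‖²_HS`, η-currency `‖↑E‖²_op ≤ 16·ρ²·‖E‖²_HS` (`1 ≤ 16·N·ρ²`)

Cell `pub-ymgap` (HUMAN RULINGS D-0062 ∕ D-0149), width seat `pub-ymgap-dag-n10-w1` g4; modules H4∕H4b (`…N12FlatRightInverseLetterFloor[Weighted]`, p625544∕p626934) state the floor GIVEN a plaquette of
rows; H2a (`…N12FlatLinAvgOntoPins`, p618111, g3) has the collar.  `--kind proof --supports stmt-QuantumFields-27364 --as helper`; count-neutral; THEOREMS ONLY (0 `def`, 0 `sorry`).  CONSUMED BY NAME: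
H4 `letter_floor_fderiv_msChart_one_single`, `norm_sq_lieSU_le_card_mul_opNorm_sq`, `constrEnum_ne_of_ne`; H4b `letter_floor_of_reproduce_single_weighted`; H2a `embIter_mem_maxDomT_of_adjacent`,
`embIter_mem_iff_of_isBlockUnion_succ`; module B `iterLin_eq_of_rightInverse`; r11∕r12 `B14Eq213DetSet` (`Bj_mid`, `isBlockUnion_maxDomT`), `TorusGeometry` (`Site.blockSite`, `Site.blockEquiv`,
`blockOf_blockSite`), p27 `BIJ85CurlQsstar.shift_blockSite_of_lt`.

WHY.  The consumer's `Rf` (n12-w4 g4's (χ) assembler: `ρc := √(#bonds·N)·B` from H3; n12-w5's `hNFn_of_letters[_eta_on]`) lives at `Bj ν.M₁ (Z i) (k i)`; H4∕H4b displayed the plaquette as four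
memberships.  Here the plaquette is CONSTRUCTED from the two facts every genuine instance has — the deep region `Ω_{i+1}(Z)` is neither empty nor the whole torus at scale `i+1`: a boundary
pair `W ∉ Ω_{i+1}^{(i+1)} ∋ W + e_μ` exists (§1, the torus is connected under unit shifts), and by H2a's COLLAR every `i`-sub-block of `W` has its centre in `Ω_i` while (block-union
measurability) none has it in `Ω_{i+1}` — so all `L^d ≥ 3^d` sub-blocks of `W` lie in `Γ_i = Ω_i ∖ Ω_{i+1}`, and the corner sub-block with its two forward neighbours is a unit square of level-`i` ROWS
of `Bj M₁ Z k` (`Bj_mid`).  The floor then follows from H4∕H4b at level `i`; at `i = k − 1` it is one level short of the deepest (the deepest level needs the cube structure of `Ω_k` itself —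
not typed here).

CONTENTS (ns `Summit.QuantumFields.YangMills.BalabanUVNodes.N12FlatRightInverseLetterFloorAtRecord`).  §1 `iterate_shift`, `mem_of_closed_under_shift`, ★ `exists_boundary_pair`
(torus connectivity).  §2 `blockSite_injective`, ★★ `exists_plaquette_rows_Bj` (the unit square of level-`i` rows from a boundary pair at scale `i+1`), ★★ `exists_plaquette_rows_Bj_zero` (level `0`, from one site outside `Ω₁`).  §3 `letter_floor_fderiv_msChart_one_single_weighted`
(H4's generic-`𝔹` J-C floor with an arbitrary weight — the level-generic form H4b states only at level `k`).  §4 ★★★ `letter_floor_at_record_sup`, ★★★ `letter_floor_at_record_eta`, ★★★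
`letter_floor_at_record_eta_numeral`, ★★★ `letter_floor_at_record_eta_numeral_zero` (level `0`: `k ≥ 1`, `Ω₁ ≠` torus ⟹ `1 ≤ 16Nρ²` — with the former, the η-floor at EVERY instance).

HONEST FRAMING.  Lattice bookkeeping + H4∕H4b by name; a floor under ONE letter (J-C's `ρc`) from structural hypotheses (`2 ≤ M₁`, `2 ≤ d`, `1 ≤ i`, `i + 1 ≤ k ≤ m + K`, `L^k·M₁ ∣ sitesPerDir 0`,
`Ω_{i+1}` non-empty and proper at scale `i+1`); nothing of Bałaban's asserted or denied; the O(1) UPPER letter stays the open (46)-class item; N12 ∕ N10 NOT discharged; K1⁹ NOT closed; count-neutral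
(typed 28∕28 · discharged 5∕27 unmoved); one finite 𝕋⁴ programme at fixed ε — R4 closes the conditional finite-𝕋⁴ rung `BalabanLadder.UV` only; the YM mass gap (Clay) is NOT proved by any of this.
-/

noncomputable section
open scoped BigOperators Matrix.Norms.L2Operator
open Finset
namespace Summit.QuantumFields.YangMills.BalabanUVNodes.N12FlatRightInverseLetterFloorAtRecord

open Literature.MathematicalPhysics.QuantumFieldTheory.Balaban1983to89
open T4Continuum (T4Family)
open BlockAveragingEMLLinearised (linAvg)
open T4AdjointCovarianceUnitary (lieSU)
open B15DeterminingSets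
open B14.Eq213DetSet (Bj maxDomT Bj_mid Bj_zero isBlockUnion_maxDomT)
open B14.Eq213MaximalDomains (side)
open Node00
open Summit.QuantumFields.YangMills.Theorems.ChartHInv (exists_linFamily)
open Summit.QuantumFields.YangMills.BalabanUVNodes.N12FlatChartDerivIterLin (iterLin_eq_of_rightInverse)
open Summit.QuantumFields.YangMills.BalabanUVNodes.N12FlatRightInverseLetterFloor (letter_floor_fderiv_msChart_one_single norm_sq_lieSU_le_card_mul_opNorm_sq constrEnum_ne_of_ne)
open Summit.QuantumFields.YangMills.BalabanUVNodes.N12FlatRightInverseLetterFloorWeighted (letter_floor_of_reproduce_single_weighted)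
open Summit.QuantumFields.YangMills.BalabanUVNodes.N12FlatLinAvgOntoPins (embIter_mem_maxDomT_of_adjacent embIter_mem_iff_of_isBlockUnion_succ)
open Literature.MathematicalPhysics.QuantumFieldTheory.BalabanImbrieJaffe1984to88.BIJ85CurlQsstar (shift_blockSite_of_lt)

variable {P : Params}

/-! ## §1  The torus is connected under unit shifts: a non-empty proper subset has a boundary pair -/

section Connectivity

variable {n : ℕ}

/-- `t` unit steps in direction `μ` add `t` to the `μ`-coordinate. [folklore] -/
theorem iterate_shift (μ : Fin P.d) (t : ℕ) (x : Site P n) :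
    (fun z : Site P n => z.shift μ)^[t] x = Function.update x μ (x μ + (t : ZMod (P.sitesPerDir n))) := by
  induction t with
  | zero => simp
  | succ t ih =>
    rw [Function.iterate_succ_apply', ih]
    funext ν
    simp only [Site.shift, Function.update_apply]
    by_cases h : ν = μ
    · subst h; simp; ring
    · simp [h]

/-- A set closed under every unit shift and containing one site is everything (reach any site coordinate by coordinate). [folklore] -/
theorem mem_of_closed_under_shift {T : Set (Site P n)} (hT : ∀ x ∈ T, ∀ μ, x.shift μ ∈ T) {x₀ : Site P n} (hx₀ : x₀ ∈ T) (y : Site P n) : y ∈ T := by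
  classical
  -- iterated shifts stay in `T`
  have hit : ∀ (μ : Fin P.d) (t : ℕ) (x : Site P n), x ∈ T → (fun z : Site P n => z.shift μ)^[t] x ∈ T := by
    intro μ t
    induction t with
    | zero => intro x hx; exact hx
    | succ t ih => intro x hx; rw [Function.iterate_succ_apply']; exact hT _ (ih x hx) μ
  -- adjust the coordinates in a finite set `s` to those of `y`
  have hreach : ∀ s : Finset (Fin P.d), (fun ν => if ν ∈ s then y ν else x₀ ν : Site P n) ∈ T := by
    intro s
    induction s using Finset.induction_on with
    | empty =>
      have h0 : (fun ν => if ν ∈ (∅ : Finset (Fin P.d)) then y ν else x₀ ν : Site P n) = x₀ := by funext ν; simp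
      rw [h0]; exact hx₀
    | insert μ s hμ ih =>
      set z : Site P n := fun ν => if ν ∈ s then y ν else x₀ ν with hz
      have h := hit μ ((y μ - z μ).val) z ih
      rw [iterate_shift, ZMod.natCast_zmod_val, add_sub_cancel] at h
      have heq : (fun ν => if ν ∈ insert μ s then y ν else x₀ ν : Site P n) = Function.update z μ (y μ) := by
        funext ν
        simp only [Finset.mem_insert, Function.update_apply, hz]
        by_cases h1 : ν = μ
        · subst h1; simp
        · simp [h1]
      rw [heq]
      exact h
  have hy : y = (fun ν => if ν ∈ (Finset.univ : Finset (Fin P.d)) then y ν else x₀ ν : Site P n) := by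
    funext ν; simp
  rw [hy]
  exact hreach _

/-- ★ **A NON-EMPTY PROPER SUBSET OF THE TORUS HAS A BOUNDARY PAIR**: some `W ∉ S` with `W + e_μ ∈ S`. [folklore] -/
theorem exists_boundary_pair {S : Set (Site P n)} (hne : ∃ a, a ∈ S) (hpr : ∃ b, b ∉ S) : ∃ (W : Site P n) (μ : Fin P.d), W ∉ S ∧ W.shift μ ∈ S := by
  by_contra h
  push Not at h
  obtain ⟨a, ha⟩ := hne
  obtain ⟨b, hb⟩ := hpr
  have hcl : ∀ x ∈ Sᶜ, ∀ μ, x.shift μ ∈ Sᶜ := fun x hx μ hs => h x μ hx hs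
  exact (mem_of_closed_under_shift hcl hb a) ha

end Connectivity

/-! ## §2  From a boundary pair at scale `i+1` to a unit square of level-`i` ROWS of `𝐁_k(Z)` -/

section Plaquette

variable {i : ℕ}

/-- Block offsets parametrise the block injectively. [cite: Balaban1984PropagatorsI, (1.11) p.19 (bookkeeping)] -/
theorem blockSite_injective (hi : i + 1 ≤ P.m + P.K) (W : Site P (i + 1)) : Function.Injective (Site.blockSite W) := by
  intro r r' h
  have h1 : (Site.blockEquiv hi W).symm r = (Site.blockEquiv hi W).symm r' := Subtype.ext h
  exact (Site.blockEquiv hi W).symm.injective h1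

/-- ★★ **THE PLAQUETTE OF ROWS.**  `2 ≤ M₁`, `2 ≤ d`, `1 ≤ i`, `i + 1 ≤ k ≤ m + K`, `L^k·M₁ ∣ sitesPerDir 0`; a boundary pair `W ∉ Ω_{i+1}^{(i+1)} ∋ W + e_μ` of the deep region
`Ω_{i+1} = maxDomT M₁ Z (i+1)`.  Then with `x :=` the corner `i`-sub-block of `W` and `μ′ = 0`, `ν′ = 1`: `x + e_{ν′} ≠ x` and the four bonds `⟨x,μ′⟩, ⟨x+e_{μ′},ν′⟩, ⟨x+e_{ν′},μ′⟩, ⟨x,ν′⟩` are level-`i`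
ROWS of `Bj M₁ Z k` (their sources are sub-blocks of `W`, whose centres lie in `Ω_i` by H2a's collar and outside `Ω_{i+1}` by block-union measurability, i.e. in `Γ_i`; `Bj_mid`).
[cite: Balaban1988Convergent, (2.2) p.255, (2.13) pp.256-257; Balaban1987RG1, (0.1) p.251] -/
theorem exists_plaquette_rows_Bj {M₁ k : ℕ} (hM2 : 2 ≤ M₁) (hd : 2 ≤ P.d) (hi1 : 1 ≤ i) (hik : i + 1 ≤ k) (hkK : k ≤ P.m + P.K) {Z : Set (Site P 0)}
    (hdiv : side P.L M₁ k ∣ P.sitesPerDir 0) {W : Site P (i + 1)} {μ : Fin P.d}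
    (hW : embIter (i + 1) W ∉ maxDomT M₁ Z (i + 1)) (hWμ : embIter (i + 1) (W.shift μ) ∈ maxDomT M₁ Z (i + 1)) :
    ∃ (x : Site P i) (μ' ν' : Fin P.d), μ' ≠ ν' ∧ x.shift ν' ≠ x ∧
      (⟨x, μ'⟩ : PBond P i) ∈ bondsOf ((Bj M₁ Z k : DetSet P) i) ∧ (⟨x.shift μ', ν'⟩ : PBond P i) ∈ bondsOf ((Bj M₁ Z k : DetSet P) i) ∧
      (⟨x.shift ν', μ'⟩ : PBond P i) ∈ bondsOf ((Bj M₁ Z k : DetSet P) i) ∧ (⟨x, ν'⟩ : PBond P i) ∈ bondsOf ((Bj M₁ Z k : DetSet P) i) := by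
  have hiK : i + 1 ≤ P.m + P.K := hik.trans hkK
  have hL : 1 < P.L := P.hL.2
  have hM : 1 ≤ M₁ := by omega
  -- every `i`-sub-block of `W` has its centre in `Γ_i`
  have hΓ : ∀ v : Site P i, blockOf v = W → v ∈ (Bj M₁ Z k : DetSet P) i := by
    intro v hv
    rw [Bj_mid (by omega) (by omega)]
    refine ⟨?_, ?_⟩
    · exact embIter_mem_maxDomT_of_adjacent hM2 hdiv hik hiK W μ (Or.inl hWμ) v hv
    · intro hmem
      have hbu : B14.Eq22Determines.IsBlockUnion (i + 1) (maxDomT M₁ Z (i + 1)) := isBlockUnion_maxDomT hM hdiv (by omega) hik hiK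
      have := (embIter_mem_iff_of_isBlockUnion_succ hbu hiK v).1 hmem
      rw [hv] at this
      exact hW this
  -- the corner sub-block and its two forward neighbours
  let r₀ : Fin P.d → Fin P.L := fun _ => ⟨0, P.L_pos⟩
  let μ' : Fin P.d := ⟨0, by omega⟩
  let ν' : Fin P.d := ⟨1, by omega⟩
  have hμν : μ' ≠ ν' := by simp [μ', ν', Fin.ext_iff]
  let x : Site P i := Site.blockSite W r₀
  have hx : blockOf x = W := Site.blockOf_blockSite hiK W r₀
  have hshift : ∀ κ : Fin P.d, x.shift κ = Site.blockSite W (Function.update r₀ κ ⟨0 + 1, by omega⟩) := fun κ =>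
    shift_blockSite_of_lt W r₀ κ (by show 0 + 1 < P.L; omega)
  have hxκ : ∀ κ : Fin P.d, blockOf (x.shift κ) = W := fun κ => by rw [hshift κ, Site.blockOf_blockSite hiK]
  have hne : x.shift ν' ≠ x := by
    intro h
    rw [hshift ν'] at h
    have h2 := blockSite_injective hiK W h
    have h3 := congrFun h2 ν'
    simp [r₀] at h3
  exact ⟨x, μ', ν', hμν, hne, Or.inl (hΓ x hx), Or.inl (hΓ _ (hxκ μ')), Or.inl (hΓ _ (hxκ ν')), Or.inl (hΓ x hx)⟩

/-- ★★ **THE PLAQUETTE OF LEVEL-0 ROWS** (`Γ₀ = Ω₁ᶜ`, `Bj_zero`): `1 ≤ k ≤ m + K`, `2 ≤ d`, `L^k·M₁ ∣ sitesPerDir 0` (`1 ≤ M₁`), one fine site `x₀ ∉ Ω₁ = maxDomT M₁ Z 1`.  Then the corner site `x` of the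
`1`-block of `x₀` and its forward neighbours carry a unit square of level-`0` rows of `Bj M₁ Z k` (the whole `1`-block avoids `Ω₁` by block-union measurability).
[cite: Balaban1988Convergent, (2.2) p.255, (2.13) pp.256-257; Balaban1987RG1, (0.1) p.251] -/
theorem exists_plaquette_rows_Bj_zero {M₁ k : ℕ} (hM : 1 ≤ M₁) (hd : 2 ≤ P.d) (hk1 : 1 ≤ k) (hkK : k ≤ P.m + P.K) {Z : Set (Site P 0)}
    (hdiv : side P.L M₁ k ∣ P.sitesPerDir 0) {x₀ : Site P 0} (hx₀ : x₀ ∉ maxDomT M₁ Z 1) :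
    ∃ (x : Site P 0) (μ' ν' : Fin P.d), μ' ≠ ν' ∧ x.shift ν' ≠ x ∧
      (⟨x, μ'⟩ : PBond P 0) ∈ bondsOf ((Bj M₁ Z k : DetSet P) 0) ∧ (⟨x.shift μ', ν'⟩ : PBond P 0) ∈ bondsOf ((Bj M₁ Z k : DetSet P) 0) ∧
      (⟨x.shift ν', μ'⟩ : PBond P 0) ∈ bondsOf ((Bj M₁ Z k : DetSet P) 0) ∧ (⟨x, ν'⟩ : PBond P 0) ∈ bondsOf ((Bj M₁ Z k : DetSet P) 0) := by
  have h1K : 0 + 1 ≤ P.m + P.K := by omega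
  have hL : 1 < P.L := P.hL.2
  have hbu : B14.Eq22Determines.IsBlockUnion 1 (maxDomT M₁ Z 1) := isBlockUnion_maxDomT hM hdiv le_rfl hk1 (by omega)
  set W : Site P 1 := blockOf x₀ with hWdef
  -- the whole `1`-block of `x₀` avoids `Ω₁`
  have hΓ : ∀ v : Site P 0, blockOf v = W → v ∈ (Bj M₁ Z k : DetSet P) 0 := by
    intro v hv
    rw [Bj_zero (by omega), Set.mem_compl_iff]
    intro hvin
    have h1 := (hbu v).1 hvin
    rw [B14.Eq22Determines.blockIter_succ, B14.Eq22Determines.blockIter_zero, hv, hWdef] at h1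
    exact hx₀ ((hbu x₀).2 h1)
  let r₀ : Fin P.d → Fin P.L := fun _ => ⟨0, P.L_pos⟩
  let μ' : Fin P.d := ⟨0, by omega⟩
  let ν' : Fin P.d := ⟨1, by omega⟩
  have hμν : μ' ≠ ν' := by simp [μ', ν', Fin.ext_iff]
  let x : Site P 0 := Site.blockSite W r₀
  have hx : blockOf x = W := Site.blockOf_blockSite h1K W r₀
  have hshift : ∀ κ : Fin P.d, x.shift κ = Site.blockSite W (Function.update r₀ κ ⟨0 + 1, by omega⟩) := fun κ =>
    shift_blockSite_of_lt W r₀ κ (by show 0 + 1 < P.L; omega)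
  have hxκ : ∀ κ : Fin P.d, blockOf (x.shift κ) = W := fun κ => by rw [hshift κ, Site.blockOf_blockSite h1K]
  have hne : x.shift ν' ≠ x := by
    intro h
    rw [hshift ν'] at h
    have h2 := blockSite_injective h1K W h
    have h3 := congrFun h2 ν'
    simp [r₀] at h3
  exact ⟨x, μ', ν', hμν, hne, Or.inl (hΓ x hx), Or.inl (hΓ _ (hxκ μ')), Or.inl (hΓ _ (hxκ ν')), Or.inl (hΓ x hx)⟩

end Plaquette

/-! ## §3  H4's J-C floor with an arbitrary weight, any level (H4b states the weighted form at level `k` only) -/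

section Weighted

variable {F : T4Family} {N : ℕ} [NeZero N] {K k : ℕ}

/-- **THE WEIGHTED FLOOR IN J-C's CURRENCY, ANY LEVEL**: rows of `𝔹` containing a level-`j` plaquette with `μ ≠ ν`, `x + e_ν ≠ x`; `Rf` a right inverse of `fderiv ℝ (msChart F N K k 𝔹 (M˙1) 1) 0` with
`p(Rf v) ≤ ρ·√(Σ_i w_i‖v i‖²)` (`p ≥` bond-`ℓ²`, `w ≥ 0`): `(L^d)^j·‖↑E‖² ≤ 16·(L²)^j·ρ²·(w(i₁)·‖E‖²)`, `i₁` the index of `⟨x, μ⟩`.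
[cite: Balaban1985Variational, (44)-(48) p.285; Balaban1988Convergent, (2.10)-(2.12) p.256; Balaban1989LargeFieldII, (17)-(19) pp.360-361] -/
theorem letter_floor_fderiv_msChart_one_single_weighted (𝔹 : DetSet (F.P K)) {j : ℕ} (hjk : j ≤ k) (hj : j ≤ (F.P K).m + (F.P K).K) (x : Site (F.P K) j) {μ ν : Fin (F.P K).d}
    (hμν : μ ≠ ν) (hx : x.shift ν ≠ x)
    (hm₁ : (⟨x, μ⟩ : PBond (F.P K) j) ∈ bondsOf (𝔹 j)) (hm₂ : (⟨x.shift μ, ν⟩ : PBond (F.P K) j) ∈ bondsOf (𝔹 j))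
    (hm₃ : (⟨x.shift ν, μ⟩ : PBond (F.P K) j) ∈ bondsOf (𝔹 j)) (hm₄ : (⟨x, ν⟩ : PBond (F.P K) j) ∈ bondsOf (𝔹 j))
    (p : Seminorm ℝ (PBond (F.P K) 0 → lieSU (Fin N))) (hp : ∀ Y : PBond (F.P K) 0 → lieSU (Fin N), ∑ b, ‖(Y b : Matrix (Fin N) (Fin N) ℂ)‖ ^ 2 ≤ p Y ^ 2)
    (Rf : (Fin (constrCard 𝔹 k) → lieSU (Fin N)) → PBond (F.P K) 0 → lieSU (Fin N))
    (hRf : ∀ v, fderiv ℝ (msChart F N K k 𝔹 (avgFamily (avOfRecord F N K) (1 : GaugeField (F.P K) 0 (SU N))) (1 : GaugeField (F.P K) 0 (SU N))) 0 (Rf v) = v)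
    (w : Fin (constrCard 𝔹 k) → ℝ) (hw : ∀ i, 0 ≤ w i) {ρ : ℝ} (hρ : ∀ v, p (Rf v) ≤ ρ * Real.sqrt (∑ i, w i * ‖v i‖ ^ 2)) (E : lieSU (Fin N)) :
    (((F.P K).L : ℝ) ^ (F.P K).d) ^ j * ‖(E : Matrix (Fin N) (Fin N) ℂ)‖ ^ 2 ≤
      16 * (((F.P K).L : ℝ) ^ 2) ^ j * ρ ^ 2 * (w (constrEnum 𝔹 k ⟨⟨j, Nat.lt_succ_of_le hjk⟩, ⟨x, μ⟩, hm₁⟩) * ‖E‖ ^ 2) := by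
  obtain ⟨Q, hQ0, hQs⟩ := exists_linFamily (P := F.P K) (n := Fin N)
  have key : ∀ (v : Fin (constrCard 𝔹 k) → lieSU (Fin N)) (idx : ConstrSet 𝔹 k),
      Q (idx.1 : ℕ) (fun b => (Rf v b : Matrix (Fin N) (Fin N) ℂ)) idx.2.1 = (v (constrEnum 𝔹 k idx) : Matrix (Fin N) (Fin N) ℂ) := by
    intro v idx
    have h := iterLin_eq_of_rightInverse (F := F) (N := N) (K := K) (k := k) Q hQ0 hQs 𝔹 Rf hRf v (constrEnum 𝔹 k idx)
    rwa [Equiv.symm_apply_apply] at h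
  exact letter_floor_of_reproduce_single_weighted Q hQ0 hQs hj x μ ν p hp Rf
    (constrEnum 𝔹 k ⟨⟨j, Nat.lt_succ_of_le hjk⟩, ⟨x, μ⟩, hm₁⟩) (constrEnum 𝔹 k ⟨⟨j, Nat.lt_succ_of_le hjk⟩, ⟨x.shift μ, ν⟩, hm₂⟩)
    (constrEnum 𝔹 k ⟨⟨j, Nat.lt_succ_of_le hjk⟩, ⟨x.shift ν, μ⟩, hm₃⟩) (constrEnum 𝔹 k ⟨⟨j, Nat.lt_succ_of_le hjk⟩, ⟨x, ν⟩, hm₄⟩)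
    (constrEnum_ne_of_ne 𝔹 (j := ⟨j, Nat.lt_succ_of_le hjk⟩) (c := ⟨⟨x.shift μ, ν⟩, hm₂⟩) (c' := ⟨⟨x, μ⟩, hm₁⟩) fun h => hμν (congrArg PBond.dir h).symm)
    (constrEnum_ne_of_ne 𝔹 (j := ⟨j, Nat.lt_succ_of_le hjk⟩) (c := ⟨⟨x.shift ν, μ⟩, hm₃⟩) (c' := ⟨⟨x, μ⟩, hm₁⟩) fun h => hx (congrArg PBond.src h))
    (constrEnum_ne_of_ne 𝔹 (j := ⟨j, Nat.lt_succ_of_le hjk⟩) (c := ⟨⟨x, ν⟩, hm₄⟩) (c' := ⟨⟨x, μ⟩, hm₁⟩) fun h => hμν (congrArg PBond.dir h).symm)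
    (fun v => key v ⟨⟨j, Nat.lt_succ_of_le hjk⟩, ⟨x, μ⟩, hm₁⟩) (fun v => key v ⟨⟨j, Nat.lt_succ_of_le hjk⟩, ⟨x.shift μ, ν⟩, hm₂⟩)
    (fun v => key v ⟨⟨j, Nat.lt_succ_of_le hjk⟩, ⟨x.shift ν, μ⟩, hm₃⟩) (fun v => key v ⟨⟨j, Nat.lt_succ_of_le hjk⟩, ⟨x, ν⟩, hm₄⟩) w (hw _) hρ E

end Weighted

/-! ## §4  The floor at the record under structural hypotheses only -/

section Record

variable {F : T4Family} {N : ℕ} [NeZero N] {K : ℕ}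

/-- ★★★ **THE LETTER FLOOR AT `𝐁_k(Z)`, SUP-CURRENCY, STRUCTURAL HYPOTHESES ONLY.**  `2 ≤ M₁`, `2 ≤ d`, `1 ≤ i`, `i + 1 ≤ k ≤ m + K`, `L^k·M₁ ∣ sitesPerDir 0`, and the deep region
`Ω_{i+1}(Z) = maxDomT M₁ Z (i+1)` non-empty and proper at scale `i+1`.  Then EVERY right inverse `Rf` of J-C's flat `Lf := fderiv ℝ (msChart F N K k (Bj M₁ Z k) (M˙1) 1) 0` with `p(Rf v) ≤ ρ‖v‖`
(`p ≥` bond-`ℓ²`, `‖v‖` = sup of the `𝔰𝔲(N)` norms) satisfies `(L^d)^i·‖↑E‖²_op ≤ 16·(L²)^i·ρ²·‖E‖²_HS` for every `E ∈ 𝔰𝔲(N)` — at `i = k − 1`: `ρ ≥ L^{(d−2)(k−1)∕2}∕(4√N)`.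
[cite: Balaban1988Convergent, (2.2) p.255, (2.13) pp.256-257, (2.10)-(2.12) p.256; Balaban1985Variational, (44)-(48) p.285; Balaban1989LargeFieldII, (1.11)-(1.13) p.359] -/
theorem letter_floor_at_record_sup {k M₁ i : ℕ} {Z : Set (Site (F.P K) 0)} (hM2 : 2 ≤ M₁) (hd : 2 ≤ (F.P K).d) (hi1 : 1 ≤ i) (hik : i + 1 ≤ k)
    (hkK : k ≤ (F.P K).m + (F.P K).K) (hdiv : side (F.P K).L M₁ k ∣ (F.P K).sitesPerDir 0)
    (hne : ∃ W : Site (F.P K) (i + 1), embIter (i + 1) W ∈ maxDomT M₁ Z (i + 1)) (hpr : ∃ W : Site (F.P K) (i + 1), embIter (i + 1) W ∉ maxDomT M₁ Z (i + 1))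
    (p : Seminorm ℝ (PBond (F.P K) 0 → lieSU (Fin N))) (hp : ∀ Y : PBond (F.P K) 0 → lieSU (Fin N), ∑ b, ‖(Y b : Matrix (Fin N) (Fin N) ℂ)‖ ^ 2 ≤ p Y ^ 2)
    (Rf : (Fin (constrCard (Bj M₁ Z k : DetSet (F.P K)) k) → lieSU (Fin N)) → PBond (F.P K) 0 → lieSU (Fin N))
    (hRf : ∀ v, fderiv ℝ (msChart F N K k (Bj M₁ Z k) (avgFamily (avOfRecord F N K) (1 : GaugeField (F.P K) 0 (SU N))) (1 : GaugeField (F.P K) 0 (SU N))) 0 (Rf v) = v)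
    {ρ : ℝ} (hρ : ∀ v, p (Rf v) ≤ ρ * ‖v‖) (E : lieSU (Fin N)) :
    (((F.P K).L : ℝ) ^ (F.P K).d) ^ i * ‖(E : Matrix (Fin N) (Fin N) ℂ)‖ ^ 2 ≤ 16 * (((F.P K).L : ℝ) ^ 2) ^ i * ρ ^ 2 * ‖E‖ ^ 2 := by
  obtain ⟨W, μ, hW, hWμ⟩ := exists_boundary_pair (S := {W : Site (F.P K) (i + 1) | embIter (i + 1) W ∈ maxDomT M₁ Z (i + 1)}) hne hpr
  obtain ⟨x, μ', ν', hμν, hx, hm₁, hm₂, hm₃, hm₄⟩ := exists_plaquette_rows_Bj hM2 hd hi1 hik hkK hdiv hW hWμ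
  exact letter_floor_fderiv_msChart_one_single (Bj M₁ Z k) (by omega) (by omega) x hμν hx hm₁ hm₂ hm₃ hm₄ p hp Rf hRf hρ E

/-- ★★★ **THE LETTER FLOOR AT `𝐁_k(Z)`, η-CURRENCY, STRUCTURAL HYPOTHESES ONLY**: as above with `p(Rf v) ≤ ρ·q_η(v)`, `q_η(v)² = Σ_i ((L^d)∕(L²))^{j_i}·‖v i‖²` (the Defs file's `qEta`, spelled as
the lambda of H4b ∕ n12-w5's `hNFn_of_letters_eta_on`): `‖↑E‖²_op ≤ 16·ρ²·‖E‖²_HS` — uniform in `i`, `k`, the volume and the construction.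
[cite: Balaban1989LargeFieldII, (17)-(19) pp.360-361; Balaban1988Convergent, (2.13) pp.256-257; Balaban1985Variational, (44)-(48) p.285] -/
theorem letter_floor_at_record_eta {k M₁ i : ℕ} {Z : Set (Site (F.P K) 0)} (hM2 : 2 ≤ M₁) (hd : 2 ≤ (F.P K).d) (hi1 : 1 ≤ i) (hik : i + 1 ≤ k)
    (hkK : k ≤ (F.P K).m + (F.P K).K) (hdiv : side (F.P K).L M₁ k ∣ (F.P K).sitesPerDir 0)
    (hne : ∃ W : Site (F.P K) (i + 1), embIter (i + 1) W ∈ maxDomT M₁ Z (i + 1)) (hpr : ∃ W : Site (F.P K) (i + 1), embIter (i + 1) W ∉ maxDomT M₁ Z (i + 1))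
    (p : Seminorm ℝ (PBond (F.P K) 0 → lieSU (Fin N))) (hp : ∀ Y : PBond (F.P K) 0 → lieSU (Fin N), ∑ b, ‖(Y b : Matrix (Fin N) (Fin N) ℂ)‖ ^ 2 ≤ p Y ^ 2)
    (Rf : (Fin (constrCard (Bj M₁ Z k : DetSet (F.P K)) k) → lieSU (Fin N)) → PBond (F.P K) 0 → lieSU (Fin N))
    (hRf : ∀ v, fderiv ℝ (msChart F N K k (Bj M₁ Z k) (avgFamily (avOfRecord F N K) (1 : GaugeField (F.P K) 0 (SU N))) (1 : GaugeField (F.P K) 0 (SU N))) 0 (Rf v) = v)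
    {ρ : ℝ} (hρ : ∀ v, p (Rf v) ≤ ρ * Real.sqrt (∑ i', ((((F.P K).L : ℝ) ^ (F.P K).d) / (((F.P K).L : ℝ) ^ 2)) ^ (((constrEnum (Bj M₁ Z k : DetSet (F.P K)) k).symm i').1 : ℕ) * ‖v i'‖ ^ 2))
    (E : lieSU (Fin N)) :
    ‖(E : Matrix (Fin N) (Fin N) ℂ)‖ ^ 2 ≤ 16 * ρ ^ 2 * ‖E‖ ^ 2 := by
  have hL : (0 : ℝ) < ((F.P K).L : ℝ) := Nat.cast_pos.mpr (F.P K).L_pos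
  have hM : (0 : ℝ) < (((F.P K).L : ℝ) ^ (F.P K).d) ^ i := by positivity
  obtain ⟨W, μ, hW, hWμ⟩ := exists_boundary_pair (S := {W : Site (F.P K) (i + 1) | embIter (i + 1) W ∈ maxDomT M₁ Z (i + 1)}) hne hpr
  obtain ⟨x, μ', ν', hμν, hx, hm₁, hm₂, hm₃, hm₄⟩ := exists_plaquette_rows_Bj hM2 hd hi1 hik hkK hdiv hW hWμ
  have h := letter_floor_fderiv_msChart_one_single_weighted (Bj M₁ Z k) (by omega) (by omega) x hμν hx hm₁ hm₂ hm₃ hm₄ p hp Rf hRf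
    (fun i' => ((((F.P K).L : ℝ) ^ (F.P K).d) / (((F.P K).L : ℝ) ^ 2)) ^ (((constrEnum (Bj M₁ Z k : DetSet (F.P K)) k).symm i').1 : ℕ)) (fun i' => by positivity) hρ E
  simp only [Equiv.symm_apply_apply] at h
  have hwt : (((F.P K).L : ℝ) ^ 2) ^ i * ((((F.P K).L : ℝ) ^ (F.P K).d) / (((F.P K).L : ℝ) ^ 2)) ^ i = (((F.P K).L : ℝ) ^ (F.P K).d) ^ i := by
    rw [← mul_pow, mul_div_cancel₀ _ (by positivity)]
  have h2 : (((F.P K).L : ℝ) ^ (F.P K).d) ^ i * ‖(E : Matrix (Fin N) (Fin N) ℂ)‖ ^ 2 ≤ (((F.P K).L : ℝ) ^ (F.P K).d) ^ i * (16 * ρ ^ 2 * ‖E‖ ^ 2) := by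
    calc _ ≤ 16 * (((F.P K).L : ℝ) ^ 2) ^ i * ρ ^ 2 * (((((F.P K).L : ℝ) ^ (F.P K).d) / (((F.P K).L : ℝ) ^ 2)) ^ i * ‖E‖ ^ 2) := h
      _ = ((((F.P K).L : ℝ) ^ 2) ^ i * ((((F.P K).L : ℝ) ^ (F.P K).d) / (((F.P K).L : ℝ) ^ 2)) ^ i) * (16 * ρ ^ 2 * ‖E‖ ^ 2) := by ring
      _ = (((F.P K).L : ℝ) ^ (F.P K).d) ^ i * (16 * ρ ^ 2 * ‖E‖ ^ 2) := by rw [hwt]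
  exact le_of_mul_le_mul_left h2 hM

/-- ★★★ **…AS A NUMBER**: with one non-zero `E ∈ 𝔰𝔲(N)` (`2 ≤ N`): `1 ≤ 16·N·ρ²`, i.e. `ρ ≥ 1∕(4√N)` for every right inverse of J-C's flat `Lf` at `𝐁_k(Z)` in `qEta`-units — structural hypotheses
only. [cite: Balaban1989LargeFieldII, (17)-(19) pp.360-361; Balaban1985Variational, (44)-(48) p.285; Balaban1985Averaging, (17)-(19) p.21] -/
theorem letter_floor_at_record_eta_numeral {k M₁ i : ℕ} {Z : Set (Site (F.P K) 0)} (hM2 : 2 ≤ M₁) (hd : 2 ≤ (F.P K).d) (hi1 : 1 ≤ i) (hik : i + 1 ≤ k)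
    (hkK : k ≤ (F.P K).m + (F.P K).K) (hdiv : side (F.P K).L M₁ k ∣ (F.P K).sitesPerDir 0)
    (hne : ∃ W : Site (F.P K) (i + 1), embIter (i + 1) W ∈ maxDomT M₁ Z (i + 1)) (hpr : ∃ W : Site (F.P K) (i + 1), embIter (i + 1) W ∉ maxDomT M₁ Z (i + 1))
    (p : Seminorm ℝ (PBond (F.P K) 0 → lieSU (Fin N))) (hp : ∀ Y : PBond (F.P K) 0 → lieSU (Fin N), ∑ b, ‖(Y b : Matrix (Fin N) (Fin N) ℂ)‖ ^ 2 ≤ p Y ^ 2)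
    (Rf : (Fin (constrCard (Bj M₁ Z k : DetSet (F.P K)) k) → lieSU (Fin N)) → PBond (F.P K) 0 → lieSU (Fin N))
    (hRf : ∀ v, fderiv ℝ (msChart F N K k (Bj M₁ Z k) (avgFamily (avOfRecord F N K) (1 : GaugeField (F.P K) 0 (SU N))) (1 : GaugeField (F.P K) 0 (SU N))) 0 (Rf v) = v)
    {ρ : ℝ} (hρ : ∀ v, p (Rf v) ≤ ρ * Real.sqrt (∑ i', ((((F.P K).L : ℝ) ^ (F.P K).d) / (((F.P K).L : ℝ) ^ 2)) ^ (((constrEnum (Bj M₁ Z k : DetSet (F.P K)) k).symm i').1 : ℕ) * ‖v i'‖ ^ 2))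
    {E : lieSU (Fin N)} (hE : E ≠ 0) : 1 ≤ 16 * (N : ℝ) * ρ ^ 2 := by
  have h := letter_floor_at_record_eta hM2 hd hi1 hik hkK hdiv hne hpr p hp Rf hRf hρ E
  have hEx := norm_sq_lieSU_le_card_mul_opNorm_sq E
  have hE' : (E : Matrix (Fin N) (Fin N) ℂ) ≠ 0 := fun h0 => hE (Subtype.ext h0)
  have hpos : 0 < ‖(E : Matrix (Fin N) (Fin N) ℂ)‖ ^ 2 := by positivity
  have h2 : 1 * ‖(E : Matrix (Fin N) (Fin N) ℂ)‖ ^ 2 ≤ (16 * (N : ℝ) * ρ ^ 2) * ‖(E : Matrix (Fin N) (Fin N) ℂ)‖ ^ 2 := by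
    calc 1 * ‖(E : Matrix (Fin N) (Fin N) ℂ)‖ ^ 2 = ‖(E : Matrix (Fin N) (Fin N) ℂ)‖ ^ 2 := one_mul _
      _ ≤ 16 * ρ ^ 2 * ‖E‖ ^ 2 := h
      _ ≤ 16 * ρ ^ 2 * ((N : ℝ) * ‖(E : Matrix (Fin N) (Fin N) ℂ)‖ ^ 2) := mul_le_mul_of_nonneg_left hEx (by positivity)
      _ = (16 * (N : ℝ) * ρ ^ 2) * ‖(E : Matrix (Fin N) (Fin N) ℂ)‖ ^ 2 := by ring
  exact le_of_mul_le_mul_right h2 hpos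

/-- ★★★ **THE η-FLOOR AT LEVEL 0 FOR EVERY INSTANCE WITH `k ≥ 1` AND `Ω₁(Z) ≠` the whole torus** (no non-emptiness needed): `1 ≤ 16·N·ρ²` for every right inverse of J-C's flat `Lf` at `𝐁_k(Z)` in
`qEta`-units — together with `letter_floor_at_record_eta_numeral` the k-uniform floor `ρ ≥ 1∕(4√N)` holds at every instance of the knit.
[cite: Balaban1989LargeFieldII, (17)-(19) pp.360-361; Balaban1988Convergent, (2.2) p.255, (2.13) pp.256-257; Balaban1985Variational, (44)-(48) p.285] -/
theorem letter_floor_at_record_eta_numeral_zero {k M₁ : ℕ} {Z : Set (Site (F.P K) 0)} (hM : 1 ≤ M₁) (hd : 2 ≤ (F.P K).d) (hk1 : 1 ≤ k) (hkK : k ≤ (F.P K).m + (F.P K).K)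
    (hdiv : side (F.P K).L M₁ k ∣ (F.P K).sitesPerDir 0) (hpr : ∃ x₀ : Site (F.P K) 0, x₀ ∉ maxDomT M₁ Z 1)
    (p : Seminorm ℝ (PBond (F.P K) 0 → lieSU (Fin N))) (hp : ∀ Y : PBond (F.P K) 0 → lieSU (Fin N), ∑ b, ‖(Y b : Matrix (Fin N) (Fin N) ℂ)‖ ^ 2 ≤ p Y ^ 2)
    (Rf : (Fin (constrCard (Bj M₁ Z k : DetSet (F.P K)) k) → lieSU (Fin N)) → PBond (F.P K) 0 → lieSU (Fin N))
    (hRf : ∀ v, fderiv ℝ (msChart F N K k (Bj M₁ Z k) (avgFamily (avOfRecord F N K) (1 : GaugeField (F.P K) 0 (SU N))) (1 : GaugeField (F.P K) 0 (SU N))) 0 (Rf v) = v)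
    {ρ : ℝ} (hρ : ∀ v, p (Rf v) ≤ ρ * Real.sqrt (∑ i', ((((F.P K).L : ℝ) ^ (F.P K).d) / (((F.P K).L : ℝ) ^ 2)) ^ (((constrEnum (Bj M₁ Z k : DetSet (F.P K)) k).symm i').1 : ℕ) * ‖v i'‖ ^ 2))
    {E : lieSU (Fin N)} (hE : E ≠ 0) : 1 ≤ 16 * (N : ℝ) * ρ ^ 2 := by
  obtain ⟨x₀, hx₀⟩ := hpr
  obtain ⟨x, μ', ν', hμν, hx, hm₁, hm₂, hm₃, hm₄⟩ := exists_plaquette_rows_Bj_zero hM hd hk1 hkK hdiv hx₀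
  have h := letter_floor_fderiv_msChart_one_single_weighted (Bj M₁ Z k) (Nat.zero_le k) (Nat.zero_le _) x hμν hx hm₁ hm₂ hm₃ hm₄ p hp Rf hRf
    (fun i' => ((((F.P K).L : ℝ) ^ (F.P K).d) / (((F.P K).L : ℝ) ^ 2)) ^ (((constrEnum (Bj M₁ Z k : DetSet (F.P K)) k).symm i').1 : ℕ)) (fun i' => by positivity) hρ E
  simp only [Equiv.symm_apply_apply, pow_zero, one_mul] at h
  have hEx := norm_sq_lieSU_le_card_mul_opNorm_sq E
  have hE' : (E : Matrix (Fin N) (Fin N) ℂ) ≠ 0 := fun h0 => hE (Subtype.ext h0)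
  have hpos : 0 < ‖(E : Matrix (Fin N) (Fin N) ℂ)‖ ^ 2 := by positivity
  have h2 : 1 * ‖(E : Matrix (Fin N) (Fin N) ℂ)‖ ^ 2 ≤ (16 * (N : ℝ) * ρ ^ 2) * ‖(E : Matrix (Fin N) (Fin N) ℂ)‖ ^ 2 := by
    calc 1 * ‖(E : Matrix (Fin N) (Fin N) ℂ)‖ ^ 2 = ‖(E : Matrix (Fin N) (Fin N) ℂ)‖ ^ 2 := one_mul _
      _ ≤ 16 * ρ ^ 2 * ‖E‖ ^ 2 := by linarith [h]
      _ ≤ 16 * ρ ^ 2 * ((N : ℝ) * ‖(E : Matrix (Fin N) (Fin N) ℂ)‖ ^ 2) := mul_le_mul_of_nonneg_left hEx (by positivity)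
      _ = (16 * (N : ℝ) * ρ ^ 2) * ‖(E : Matrix (Fin N) (Fin N) ℂ)‖ ^ 2 := by ring
  exact le_of_mul_le_mul_right h2 hpos

end Record

end Summit.QuantumFields.YangMills.BalabanUVNodes.N12FlatRightInverseLetterFloorAtRecord
end
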